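import Summits.MatrixMultiplication.OmegaCensus.STPP211CosetReflectB
import Summits.MatrixMultiplication.OmegaCensus.STPP211Z2pow6CosetDecide1
import Summits.MatrixMultiplication.OmegaCensus.STPP211Z2pow6CosetDecide2
import Summits.MatrixMultiplication.OmegaCensus.STPP211Z2pow6CosetDecide3
import Summits.MatrixMultiplication.OmegaCensus.STPP211Z2pow6CosetDecide4
import Mathlib.Tactic.FinCases

/-!
# (2,1,1)¹⁰ ⊄ (ℤ/2)⁶ — part E: NO FAMILY over 18 of the 29 affine classes of `c`-sets (the COSET LAW, kernel)

Cell `pub-omega` (unit `pub-omega-stpp-1-g36`), topic `Summits/MatrixMultiplication/OmegaCensus`.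
HONEST FRAMING (verbatim): lottery ticket; floor = certified bounds/negative ranges. Census STRUCTURE bookkeeping (B5, the threshold column
`T1(H) = max {k : (2,1,1)^k ⊆ H}` at `(ℤ/2)⁶`, row Pb237: `T1((ℤ/2)⁶) = 9` is KERNEL for `≥` and ENGINE for `≤`); nothing here is a bound on `ω`.

WHAT IS PROVED (kernel, unconditional). For each of 18 ten-point `c`-code lists `cs` below — representatives #1–#6, #10, #12–#16, #18, #19,
#24, #26, #28, #29 of the 29 `AGL(6,2)`-classes of 10-subsets `C ∋ 0` of `𝔽₂⁶` (ENG2 g35's mass-formula-certified list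
`orbits_m6_k10.txt`, its line order) — there is NO STPP family (CKSU Def. 5.1, tree `IsSTPP`) of translation normal form
`(Aᵢ, {0}, {dec csᵢ})_{i<10}` in `G6 = (ℤ/2)⁶` with all `#Aᵢ = 2` (`noNF_csNN`). Mechanism = THE COSET LAW (`STPP211CosetLaw`): the
`A`-points in each coset of a coordinate hyperplane `W` form a `W`-admissible labeled set, and the kernel (`STPP211Z2pow6CosetDecide1…4`,
soundness `STPP211CosetReflectB`) finds every rooted admissible set too small: for the 15 classes of affine dimension `≤ 5` (`C ⊆ W =`
«bit 5 = 0»): fewer than `10` members, so the two cosets carry `< 20 = Σ #Aᵢ` points; for #16, #24, #26 (affine dimension 6): the nine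
blocks whose `c` is EVEN (`W =` «bit 0 = 0») admit fewer than `9` members per coset, `< 18`.
WHAT IS NOT PROVED HERE: the other 11 classes (#7–#9, #11, #17, #20–#23, #25, #27; the coset law does not bite — direct search, S2), and
the reduction of an arbitrary `(2,1,1)¹⁰` family of `(ℤ/2)⁶` to one of the 29 normal forms (S3); so no `T1` word follows from this file alone.

References: H. Cohn, R. Kleinberg, B. Szegedy, C. Umans, FOCS 2005 (arXiv:math/0511460), Def. 5.1.
-/

namespace Summit.MatrixMultiplication.OmegaCensus

namespace T1CosetEng

open Finset Literature.Computability.AlgebraicComplexity T1Z2p6 T1Coset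

/-- **Class #1 (`c`-codes `0 1 2 3 4 5 8 10 12 14`): no normal-form `(2,1,1)¹⁰` family in `(ℤ/2)⁶`** — coset law with `W =` «bit 5 = 0»
(kernel decision `searchS_cs01`, part D1). [cite: CohnKleinbergSzegedyUmans2005, Def. 5.1] -/
theorem noNF_cs01 : ¬ ∃ A : Fin 10 → Finset G6,
    IsSTPP A (fun _ => ({0} : Finset G6)) (fun i => {dec (cs01.getD i.val 0)}) ∧ ∀ i, (A i).card = 2 :=
  no_family_of_coset_bound (W := Wb 5) (fun _ _ ha hb => sub_mem_Wb_of_not_mem ha hb)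
    (cosetBound_of_searchS (k := 10) (cs := cs01) rfl (by decide) 5 searchS_cs01) (by norm_num) (by norm_num)

/-- **Class #2 (`c`-codes `0 1 2 3 4 5 8 10 12 15`): no normal-form `(2,1,1)¹⁰` family in `(ℤ/2)⁶`** — coset law with `W =` «bit 5 = 0»
(kernel decision `searchS_cs02`, part D1). [cite: CohnKleinbergSzegedyUmans2005, Def. 5.1] -/
theorem noNF_cs02 : ¬ ∃ A : Fin 10 → Finset G6,
    IsSTPP A (fun _ => ({0} : Finset G6)) (fun i => {dec (cs02.getD i.val 0)}) ∧ ∀ i, (A i).card = 2 :=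
  no_family_of_coset_bound (W := Wb 5) (fun _ _ ha hb => sub_mem_Wb_of_not_mem ha hb)
    (cosetBound_of_searchS (k := 10) (cs := cs02) rfl (by decide) 5 searchS_cs02) (by norm_num) (by norm_num)

/-- **Class #3 (`c`-codes `0 1 2 3 4 5 8 9 14 15`): no normal-form `(2,1,1)¹⁰` family in `(ℤ/2)⁶`** — coset law with `W =` «bit 5 = 0»
(kernel decision `searchS_cs03`, part D1). [cite: CohnKleinbergSzegedyUmans2005, Def. 5.1] -/
theorem noNF_cs03 : ¬ ∃ A : Fin 10 → Finset G6,
    IsSTPP A (fun _ => ({0} : Finset G6)) (fun i => {dec (cs03.getD i.val 0)}) ∧ ∀ i, (A i).card = 2 :=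
  no_family_of_coset_bound (W := Wb 5) (fun _ _ ha hb => sub_mem_Wb_of_not_mem ha hb)
    (cosetBound_of_searchS (k := 10) (cs := cs03) rfl (by decide) 5 searchS_cs03) (by norm_num) (by norm_num)

/-- **Class #4 (`c`-codes `0 1 2 3 4 5 8 9 16 17`): no normal-form `(2,1,1)¹⁰` family in `(ℤ/2)⁶`** — coset law with `W =` «bit 5 = 0»
(kernel decision `searchS_cs04`, part D1). [cite: CohnKleinbergSzegedyUmans2005, Def. 5.1] -/
theorem noNF_cs04 : ¬ ∃ A : Fin 10 → Finset G6,
    IsSTPP A (fun _ => ({0} : Finset G6)) (fun i => {dec (cs04.getD i.val 0)}) ∧ ∀ i, (A i).card = 2 :=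
  no_family_of_coset_bound (W := Wb 5) (fun _ _ ha hb => sub_mem_Wb_of_not_mem ha hb)
    (cosetBound_of_searchS (k := 10) (cs := cs04) rfl (by decide) 5 searchS_cs04) (by norm_num) (by norm_num)

/-- **Class #5 (`c`-codes `0 1 2 3 4 8 12 16 21 26`): no normal-form `(2,1,1)¹⁰` family in `(ℤ/2)⁶`** — coset law with `W =` «bit 5 = 0»
(kernel decision `searchS_cs05`, part D1). [cite: CohnKleinbergSzegedyUmans2005, Def. 5.1] -/
theorem noNF_cs05 : ¬ ∃ A : Fin 10 → Finset G6,
    IsSTPP A (fun _ => ({0} : Finset G6)) (fun i => {dec (cs05.getD i.val 0)}) ∧ ∀ i, (A i).card = 2 :=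
  no_family_of_coset_bound (W := Wb 5) (fun _ _ ha hb => sub_mem_Wb_of_not_mem ha hb)
    (cosetBound_of_searchS (k := 10) (cs := cs05) rfl (by decide) 5 searchS_cs05) (by norm_num) (by norm_num)

/-- **Class #6 (`c`-codes `0 1 2 3 4 8 15 16 23 27`): no normal-form `(2,1,1)¹⁰` family in `(ℤ/2)⁶`** — coset law with `W =` «bit 5 = 0»
(kernel decision `searchS_cs06`, part D2). [cite: CohnKleinbergSzegedyUmans2005, Def. 5.1] -/
theorem noNF_cs06 : ¬ ∃ A : Fin 10 → Finset G6,
    IsSTPP A (fun _ => ({0} : Finset G6)) (fun i => {dec (cs06.getD i.val 0)}) ∧ ∀ i, (A i).card = 2 :=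
  no_family_of_coset_bound (W := Wb 5) (fun _ _ ha hb => sub_mem_Wb_of_not_mem ha hb)
    (cosetBound_of_searchS (k := 10) (cs := cs06) rfl (by decide) 5 searchS_cs06) (by norm_num) (by norm_num)

/-- **Class #10 (`c`-codes `0 1 2 4 7 8 11 16 21 25`): no normal-form `(2,1,1)¹⁰` family in `(ℤ/2)⁶`** — coset law with `W =` «bit 5 = 0»
(kernel decision `searchS_cs10`, part D2). [cite: CohnKleinbergSzegedyUmans2005, Def. 5.1] -/
theorem noNF_cs10 : ¬ ∃ A : Fin 10 → Finset G6,
    IsSTPP A (fun _ => ({0} : Finset G6)) (fun i => {dec (cs10.getD i.val 0)}) ∧ ∀ i, (A i).card = 2 :=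
  no_family_of_coset_bound (W := Wb 5) (fun _ _ ha hb => sub_mem_Wb_of_not_mem ha hb)
    (cosetBound_of_searchS (k := 10) (cs := cs10) rfl (by decide) 5 searchS_cs10) (by norm_num) (by norm_num)

/-- **Class #12 (`c`-codes `0 1 2 4 8 11 16 19 28 31`): no normal-form `(2,1,1)¹⁰` family in `(ℤ/2)⁶`** — coset law with `W =` «bit 5 = 0»
(kernel decision `searchS_cs12`, part D2). [cite: CohnKleinbergSzegedyUmans2005, Def. 5.1] -/
theorem noNF_cs12 : ¬ ∃ A : Fin 10 → Finset G6,
    IsSTPP A (fun _ => ({0} : Finset G6)) (fun i => {dec (cs12.getD i.val 0)}) ∧ ∀ i, (A i).card = 2 :=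
  no_family_of_coset_bound (W := Wb 5) (fun _ _ ha hb => sub_mem_Wb_of_not_mem ha hb)
    (cosetBound_of_searchS (k := 10) (cs := cs12) rfl (by decide) 5 searchS_cs12) (by norm_num) (by norm_num)

/-- **Class #13 (`c`-codes `0 1 2 4 8 14 16 17 22 23`): no normal-form `(2,1,1)¹⁰` family in `(ℤ/2)⁶`** — coset law with `W =` «bit 5 = 0»
(kernel decision `searchS_cs13`, part D2). [cite: CohnKleinbergSzegedyUmans2005, Def. 5.1] -/
theorem noNF_cs13 : ¬ ∃ A : Fin 10 → Finset G6,
    IsSTPP A (fun _ => ({0} : Finset G6)) (fun i => {dec (cs13.getD i.val 0)}) ∧ ∀ i, (A i).card = 2 :=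
  no_family_of_coset_bound (W := Wb 5) (fun _ _ ha hb => sub_mem_Wb_of_not_mem ha hb)
    (cosetBound_of_searchS (k := 10) (cs := cs13) rfl (by decide) 5 searchS_cs13) (by norm_num) (by norm_num)

/-- **Class #14 (`c`-codes `0 1 2 4 8 14 16 22 26 28`): no normal-form `(2,1,1)¹⁰` family in `(ℤ/2)⁶`** — coset law with `W =` «bit 5 = 0»
(kernel decision `searchS_cs14`, part D2). [cite: CohnKleinbergSzegedyUmans2005, Def. 5.1] -/
theorem noNF_cs14 : ¬ ∃ A : Fin 10 → Finset G6,
    IsSTPP A (fun _ => ({0} : Finset G6)) (fun i => {dec (cs14.getD i.val 0)}) ∧ ∀ i, (A i).card = 2 :=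
  no_family_of_coset_bound (W := Wb 5) (fun _ _ ha hb => sub_mem_Wb_of_not_mem ha hb)
    (cosetBound_of_searchS (k := 10) (cs := cs14) rfl (by decide) 5 searchS_cs14) (by norm_num) (by norm_num)

/-- **Class #15 (`c`-codes `0 1 2 4 8 14 16 22 27 29`): no normal-form `(2,1,1)¹⁰` family in `(ℤ/2)⁶`** — coset law with `W =` «bit 5 = 0»
(kernel decision `searchS_cs15`, part D3). [cite: CohnKleinbergSzegedyUmans2005, Def. 5.1] -/
theorem noNF_cs15 : ¬ ∃ A : Fin 10 → Finset G6,
    IsSTPP A (fun _ => ({0} : Finset G6)) (fun i => {dec (cs15.getD i.val 0)}) ∧ ∀ i, (A i).card = 2 :=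
  no_family_of_coset_bound (W := Wb 5) (fun _ _ ha hb => sub_mem_Wb_of_not_mem ha hb)
    (cosetBound_of_searchS (k := 10) (cs := cs15) rfl (by decide) 5 searchS_cs15) (by norm_num) (by norm_num)

/-- **Class #18 (`c`-codes `0 1 2 4 8 15 16 17 22 23`): no normal-form `(2,1,1)¹⁰` family in `(ℤ/2)⁶`** — coset law with `W =` «bit 5 = 0»
(kernel decision `searchS_cs18`, part D3). [cite: CohnKleinbergSzegedyUmans2005, Def. 5.1] -/
theorem noNF_cs18 : ¬ ∃ A : Fin 10 → Finset G6,
    IsSTPP A (fun _ => ({0} : Finset G6)) (fun i => {dec (cs18.getD i.val 0)}) ∧ ∀ i, (A i).card = 2 :=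
  no_family_of_coset_bound (W := Wb 5) (fun _ _ ha hb => sub_mem_Wb_of_not_mem ha hb)
    (cosetBound_of_searchS (k := 10) (cs := cs18) rfl (by decide) 5 searchS_cs18) (by norm_num) (by norm_num)

/-- **Class #19 (`c`-codes `0 1 2 4 8 15 16 23 27 28`): no normal-form `(2,1,1)¹⁰` family in `(ℤ/2)⁶`** — coset law with `W =` «bit 5 = 0»
(kernel decision `searchS_cs19`, part D3). [cite: CohnKleinbergSzegedyUmans2005, Def. 5.1] -/
theorem noNF_cs19 : ¬ ∃ A : Fin 10 → Finset G6,
    IsSTPP A (fun _ => ({0} : Finset G6)) (fun i => {dec (cs19.getD i.val 0)}) ∧ ∀ i, (A i).card = 2 :=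
  no_family_of_coset_bound (W := Wb 5) (fun _ _ ha hb => sub_mem_Wb_of_not_mem ha hb)
    (cosetBound_of_searchS (k := 10) (cs := cs19) rfl (by decide) 5 searchS_cs19) (by norm_num) (by norm_num)

/-- **Class #28 (`c`-codes `0 1 2 4 8 9 15 16 17 23`): no normal-form `(2,1,1)¹⁰` family in `(ℤ/2)⁶`** — coset law with `W =` «bit 5 = 0»
(kernel decision `searchS_cs28`, part D3). [cite: CohnKleinbergSzegedyUmans2005, Def. 5.1] -/
theorem noNF_cs28 : ¬ ∃ A : Fin 10 → Finset G6,
    IsSTPP A (fun _ => ({0} : Finset G6)) (fun i => {dec (cs28.getD i.val 0)}) ∧ ∀ i, (A i).card = 2 :=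
  no_family_of_coset_bound (W := Wb 5) (fun _ _ ha hb => sub_mem_Wb_of_not_mem ha hb)
    (cosetBound_of_searchS (k := 10) (cs := cs28) rfl (by decide) 5 searchS_cs28) (by norm_num) (by norm_num)

/-- **Class #29 (`c`-codes `0 1 2 4 8 9 16 23 26 29`): no normal-form `(2,1,1)¹⁰` family in `(ℤ/2)⁶`** — coset law with `W =` «bit 5 = 0»
(kernel decision `searchS_cs29`, part D4). [cite: CohnKleinbergSzegedyUmans2005, Def. 5.1] -/
theorem noNF_cs29 : ¬ ∃ A : Fin 10 → Finset G6,
    IsSTPP A (fun _ => ({0} : Finset G6)) (fun i => {dec (cs29.getD i.val 0)}) ∧ ∀ i, (A i).card = 2 :=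
  no_family_of_coset_bound (W := Wb 5) (fun _ _ ha hb => sub_mem_Wb_of_not_mem ha hb)
    (cosetBound_of_searchS (k := 10) (cs := cs29) rfl (by decide) 5 searchS_cs29) (by norm_num) (by norm_num)

/-- Class #16: the full `c`-code list `0 1 2 4 8 14 16 22 32 38` (its odd code sits at position `1`; the even ones are `cs16i` of part D4). -/
def cs16 : List ℕ := [0, 1, 2, 4, 8, 14, 16, 22, 32, 38]

/-- **Class #16 (`c`-codes `0 1 2 4 8 14 16 22 32 38`): no normal-form `(2,1,1)¹⁰` family in `(ℤ/2)⁶`** — coset law on the SUB-FAMILY of the nine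
blocks with even `c` (positions `≠ 1`, via `Fin.succAbove 1`), `W =` «bit 0 = 0» (kernel decision `searchS_cs16i`).
[cite: CohnKleinbergSzegedyUmans2005, Def. 5.1] -/
theorem noNF_cs16 : ¬ ∃ A : Fin 10 → Finset G6,
    IsSTPP A (fun _ => ({0} : Finset G6)) (fun i => {dec (cs16.getD i.val 0)}) ∧ ∀ i, (A i).card = 2 := by
  have hB := cosetBound_of_searchS (k := 9) (cs := cs16i) rfl (by decide) 0 searchS_cs16i
  have hc : (fun j : Fin 9 => dec (cs16.getD (Fin.succAbove (1 : Fin 10) j).val 0)) = fun j => dec (cs16i.getD j.val 0) := by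
    funext j; fin_cases j <;> rfl
  have hB' : CosetBound (Wb 0) (fun j : Fin 9 => dec (cs16.getD (Fin.succAbove (1 : Fin 10) j).val 0)) 9 := by
    rw [hc]; exact hB
  exact no_family_of_coset_bound_sub (W := Wb 0) (fun _ _ ha hb => sub_mem_Wb_of_not_mem ha hb) (Fin.succAbove 1) Fin.succAbove_right_injective hB'
    (by norm_num) (by norm_num)

/-- Class #24: the full `c`-code list `0 1 2 4 8 16 28 32 44 52` (its odd code sits at position `1`; the even ones are `cs24i` of part D4). -/
def cs24 : List ℕ := [0, 1, 2, 4, 8, 16, 28, 32, 44, 52]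

/-- **Class #24 (`c`-codes `0 1 2 4 8 16 28 32 44 52`): no normal-form `(2,1,1)¹⁰` family in `(ℤ/2)⁶`** — coset law on the SUB-FAMILY of the nine
blocks with even `c` (positions `≠ 1`, via `Fin.succAbove 1`), `W =` «bit 0 = 0» (kernel decision `searchS_cs24i`).
[cite: CohnKleinbergSzegedyUmans2005, Def. 5.1] -/
theorem noNF_cs24 : ¬ ∃ A : Fin 10 → Finset G6,
    IsSTPP A (fun _ => ({0} : Finset G6)) (fun i => {dec (cs24.getD i.val 0)}) ∧ ∀ i, (A i).card = 2 := by
  have hB := cosetBound_of_searchS (k := 9) (cs := cs24i) rfl (by decide) 0 searchS_cs24i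
  have hc : (fun j : Fin 9 => dec (cs24.getD (Fin.succAbove (1 : Fin 10) j).val 0)) = fun j => dec (cs24i.getD j.val 0) := by
    funext j; fin_cases j <;> rfl
  have hB' : CosetBound (Wb 0) (fun j : Fin 9 => dec (cs24.getD (Fin.succAbove (1 : Fin 10) j).val 0)) 9 := by
    rw [hc]; exact hB
  exact no_family_of_coset_bound_sub (W := Wb 0) (fun _ _ ha hb => sub_mem_Wb_of_not_mem ha hb) (Fin.succAbove 1) Fin.succAbove_right_injective hB'
    (by norm_num) (by norm_num)

/-- Class #26: the full `c`-code list `0 1 2 4 8 16 32 38 56 62` (its odd code sits at position `1`; the even ones are `cs26i` of part D2). -/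
def cs26 : List ℕ := [0, 1, 2, 4, 8, 16, 32, 38, 56, 62]

/-- **Class #26 (`c`-codes `0 1 2 4 8 16 32 38 56 62`): no normal-form `(2,1,1)¹⁰` family in `(ℤ/2)⁶`** — coset law on the SUB-FAMILY of the nine
blocks with even `c` (positions `≠ 1`, via `Fin.succAbove 1`), `W =` «bit 0 = 0» (kernel decision `searchS_cs26i`).
[cite: CohnKleinbergSzegedyUmans2005, Def. 5.1] -/
theorem noNF_cs26 : ¬ ∃ A : Fin 10 → Finset G6,
    IsSTPP A (fun _ => ({0} : Finset G6)) (fun i => {dec (cs26.getD i.val 0)}) ∧ ∀ i, (A i).card = 2 := by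
  have hB := cosetBound_of_searchS (k := 9) (cs := cs26i) rfl (by decide) 0 searchS_cs26i
  have hc : (fun j : Fin 9 => dec (cs26.getD (Fin.succAbove (1 : Fin 10) j).val 0)) = fun j => dec (cs26i.getD j.val 0) := by
    funext j; fin_cases j <;> rfl
  have hB' : CosetBound (Wb 0) (fun j : Fin 9 => dec (cs26.getD (Fin.succAbove (1 : Fin 10) j).val 0)) 9 := by
    rw [hc]; exact hB
  exact no_family_of_coset_bound_sub (W := Wb 0) (fun _ _ ha hb => sub_mem_Wb_of_not_mem ha hb) (Fin.succAbove 1) Fin.succAbove_right_injective hB'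
    (by norm_num) (by norm_num)

end T1CosetEng

end Summit.MatrixMultiplication.OmegaCensus
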